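/-
Lane (xiv-h) «MASS-AWARE CEILING» part 2/5 — MECHANICAL CARVE (rh-split-typer-3 g2, RULING #292 (c)) of zd-neg GEN-18
`HOME/rh-split-zd-neg/g18/tree/MassAwareSamplingCeiling.lean` sha16 60d461fef9600800 (1191 l): source lines 407–649 VERBATIM
(cut at the source's `###` section-doc seams); only this header, the imports, the namespace brackets and 1 insert-only one-line docstring(s) (gate `lint.docstring`, repair xivh-a) are added per part.
Nothing here bears on the truth of RH.
-/
import Summits.RiemannHypothesis.RiemannHypothesis.Theorems.Splittings.MassAwareSamplingCeilingA

/-!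
# Splittings — zd-neg GEN-18 «MASS-AWARE CEILING» (the node `MassAwareSamplingL L 2 θ` is FALSE for every `θ ≥ 2/5`), part 2/5
(source sections G15.5 / G18.2): closed form and bounds for the visibility; counting sandwiches, floor shifts and the RING SAWTOOTH `W t q z ∈ [−(1−t), −t]`.
Full provenance, audit notes and the section map are in the source header (zd-neg g18, card `cards/SPLIT-zd-neg.md` GEN-18).

HONEST LABEL: «SPLITTING SEARCH over kernel-typed RH-EQUIVALENCES; a splitting A ∧ B ⟹ RH is CONDITIONAL bookkeeping
unless A and B are both proved; nothing here bears on the truth of RH.»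
-/

set_option linter.dupNamespace false

noncomputable section

open scoped Classical ComplexConjugate
open Set Filter Topology Complex MeasureTheory

namespace Summit.RiemannHypothesis.RiemannHypothesis.Theorems.Splittings.MassAwareSamplingCeiling

open Summit.RiemannHypothesis.RiemannHypothesis.Theorems.Splittings.BombieriTruncMassAware (Phi LocBand MassAwareSampling)

/-! ### G15.5 Closed form and bounds for the visibility -/

/-- Closed form of the visibility: `mvis L ξ = 4 sin(ξL/2) sin(ξ(2−L)/2)/ξ` for `ξ ≠ 0`. PURE. -/
theorem mvis_eq {L ξ : ℝ} (hξ : ξ ≠ 0) : mvis L ξ = 4 * Real.sin (ξ * L / 2) * Real.sin (ξ * (2 - L) / 2) / ξ := by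
  unfold mvis
  have h := intervalIntegral.integral_comp_mul_left (fun x ↦ Real.sin x) hξ (a := L - 1) (b := 1)
  rw [h, integral_sin, smul_eq_mul, mul_one, Real.cos_sub_cos]
  have e1 : (ξ * (L - 1) + ξ) / 2 = ξ * L / 2 := by ring
  have e2 : (ξ * (L - 1) - ξ) / 2 = -(ξ * (2 - L) / 2) := by ring
  rw [e1, e2, Real.sin_neg]
  field_simp
  ring


/-! ### G18.2 Counting sandwiches, floor shifts, and the RING SAWTOOTH `W t q z ∈ [−(1−t), −t]`

The ringed-planet configuration of period `p`: a PLANET of mass `(1−2t)·pD` at `p·j` and `2q` MOONS of mass `(tp/q)·D` at `p·j ± (i+1)tp/q`,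
`i < q` (so the rings fill `[p·j − tp, p·j + tp]` at exact density `D` and the hole between consecutive ring systems has length
`p − 2tp = δ₀`).  Its normalised counting function minus the flat density is
`W t q z = (1−2t)⌊z⌋ + (t/q)·Σ_{i<q} (⌊z − (i+1)t/q⌋ + ⌊z + (i+1)t/q⌋) − z`, and for `0 < t ≤ 1/3` it stays in `[−(1−t), −t]`
(oscillation `1 − 2t = δ₀/p`), for EVERY `q ≥ 1` — the `q = 1` case is the G15 trimer sawtooth. -/

/-- `#{i < q : f < (i+1)c}` is sandwiched: `q − f/c ≤ # ≤ max(q + 1 − f/c, 0)` (`c > 0`, `f ≥ 0`). -/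
theorem count_lt_sandwich {c f : ℝ} (hc : 0 < c) (hf : 0 ≤ f) (q : ℕ) :
    (q : ℝ) - f / c ≤ (∑ i ∈ Finset.range q, if f < ((i : ℝ) + 1) * c then (1 : ℝ) else 0) ∧
      (∑ i ∈ Finset.range q, if f < ((i : ℝ) + 1) * c then (1 : ℝ) else 0) ≤ max ((q : ℝ) + 1 - f / c) 0 := by
  induction q with
  | zero =>
    simp only [Finset.range_zero, Finset.sum_empty, CharP.cast_eq_zero, zero_sub, zero_add]
    exact ⟨by have := div_nonneg hf hc.le; linarith, le_max_right _ _⟩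
  | succ q ih =>
    rw [Finset.sum_range_succ]
    push_cast
    have hS0 : 0 ≤ ∑ i ∈ Finset.range q, (if f < ((i : ℝ) + 1) * c then (1 : ℝ) else 0) :=
      Finset.sum_nonneg fun i _ ↦ by split_ifs <;> norm_num
    by_cases h : f < ((q : ℝ) + 1) * c
    · rw [if_pos h]
      have hlt : f / c < (q : ℝ) + 1 := by rw [div_lt_iff₀ hc]; linarith
      have e1 : max ((q : ℝ) + 1 - f / c) 0 = (q : ℝ) + 1 - f / c := max_eq_left (by linarith)
      have e2 : max ((q : ℝ) + 1 + 1 - f / c) 0 = (q : ℝ) + 1 + 1 - f / c := max_eq_left (by linarith)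
      rw [e1] at ih
      rw [e2]
      constructor <;> linarith [ih.1, ih.2]
    · rw [if_neg h]
      push Not at h
      have hge : (q : ℝ) + 1 ≤ f / c := by rw [le_div_iff₀ hc]; linarith
      have e1 : max ((q : ℝ) + 1 - f / c) 0 = 0 := max_eq_right (by linarith)
      rw [e1] at ih
      refine ⟨by linarith, ?_⟩
      rw [add_zero]
      exact ih.2.trans (le_max_right _ _)

/-- The same sandwich for the non-strict count `#{i < q : g ≤ (i+1)c}`. -/
theorem count_le_sandwich {c g : ℝ} (hc : 0 < c) (hg : 0 ≤ g) (q : ℕ) :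
    (q : ℝ) - g / c ≤ (∑ i ∈ Finset.range q, if g ≤ ((i : ℝ) + 1) * c then (1 : ℝ) else 0) ∧
      (∑ i ∈ Finset.range q, if g ≤ ((i : ℝ) + 1) * c then (1 : ℝ) else 0) ≤ max ((q : ℝ) + 1 - g / c) 0 := by
  induction q with
  | zero =>
    simp only [Finset.range_zero, Finset.sum_empty, CharP.cast_eq_zero, zero_sub, zero_add]
    exact ⟨by have := div_nonneg hg hc.le; linarith, le_max_right _ _⟩
  | succ q ih =>
    rw [Finset.sum_range_succ]
    push_cast
    have hS0 : 0 ≤ ∑ i ∈ Finset.range q, (if g ≤ ((i : ℝ) + 1) * c then (1 : ℝ) else 0) :=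
      Finset.sum_nonneg fun i _ ↦ by split_ifs <;> norm_num
    by_cases h : g ≤ ((q : ℝ) + 1) * c
    · rw [if_pos h]
      have hle : g / c ≤ (q : ℝ) + 1 := by rw [div_le_iff₀ hc]; linarith
      have e2 : max ((q : ℝ) + 1 + 1 - g / c) 0 = (q : ℝ) + 1 + 1 - g / c := max_eq_left (by linarith)
      rw [e2]
      refine ⟨by linarith [ih.1], ?_⟩
      rcases le_or_gt 0 ((q : ℝ) + 1 - g / c) with h0 | h0
      · rw [max_eq_left h0] at ih
        linarith [ih.2]
      · rw [max_eq_right h0.le] at ih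
        linarith [ih.2]
    · rw [if_neg h]
      push Not at h
      have hgt : (q : ℝ) + 1 < g / c := by rw [lt_div_iff₀ hc]; linarith
      have e1 : max ((q : ℝ) + 1 - g / c) 0 = 0 := max_eq_right (by linarith)
      rw [e1] at ih
      refine ⟨by linarith, ?_⟩
      rw [add_zero]
      exact ih.2.trans (le_max_right _ _)

/-- `⌊z − c⌋ = ⌊z⌋ − [fract z < c]` for `0 ≤ c < 1`. -/
theorem floor_sub_eq_ite {z c : ℝ} (hc0 : 0 ≤ c) (hc1 : c < 1) :
    ((⌊z - c⌋ : ℤ) : ℝ) = (⌊z⌋ : ℝ) - if Int.fract z < c then 1 else 0 := by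
  have h1 : ((⌊z⌋ : ℤ) : ℝ) ≤ z := Int.floor_le z
  have h2 : z < ((⌊z⌋ : ℤ) : ℝ) + 1 := Int.lt_floor_add_one z
  have hf : Int.fract z = z - ⌊z⌋ := rfl
  split_ifs with h
  · rw [hf] at h
    have e : ⌊z - c⌋ = ⌊z⌋ - 1 := by
      rw [Int.floor_eq_iff]; push_cast; constructor <;> linarith
    rw [e]; push_cast; ring
  · rw [hf] at h
    push Not at h
    have e : ⌊z - c⌋ = ⌊z⌋ := by
      rw [Int.floor_eq_iff]; constructor <;> linarith
    rw [e]; ring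

/-- `⌊z + c⌋ = ⌊z⌋ + [1 ≤ fract z + c]` for `0 ≤ c < 1`. -/
theorem floor_add_eq_ite {z c : ℝ} (hc0 : 0 ≤ c) (hc1 : c < 1) :
    ((⌊z + c⌋ : ℤ) : ℝ) = (⌊z⌋ : ℝ) + if 1 ≤ Int.fract z + c then 1 else 0 := by
  have h1 : ((⌊z⌋ : ℤ) : ℝ) ≤ z := Int.floor_le z
  have h2 : z < ((⌊z⌋ : ℤ) : ℝ) + 1 := Int.lt_floor_add_one z
  have hf : Int.fract z = z - ⌊z⌋ := rfl
  split_ifs with h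
  · rw [hf] at h
    have e : ⌊z + c⌋ = ⌊z⌋ + 1 := by
      rw [Int.floor_eq_iff]; push_cast; constructor <;> linarith
    rw [e]; push_cast; ring
  · rw [hf] at h
    push Not at h
    have e : ⌊z + c⌋ = ⌊z⌋ := by
      rw [Int.floor_eq_iff]; constructor <;> linarith
    rw [e]; ring

/-- The RING SAWTOOTH: normalised counting function of the ringed-planet lattice minus the flat density. -/
def W (t : ℝ) (q : ℕ) (z : ℝ) : ℝ :=
  (1 - 2 * t) * (⌊z⌋ : ℝ) +
    t / q * (∑ i ∈ Finset.range q,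
      ((((⌊z - ((i : ℝ) + 1) * (t / q)⌋ : ℤ) : ℝ)) + ((⌊z + ((i : ℝ) + 1) * (t / q)⌋ : ℤ) : ℝ))) - z

/-- **The ring sawtooth stays in `[−(1−t), −t]`** for `0 < t ≤ 1/3`, every `q ≥ 1`. -/
theorem W_mem {t : ℝ} (ht0 : 0 < t) (ht3 : t ≤ 1 / 3) {q : ℕ} (hq : 0 < q) (z : ℝ) :
    -(1 - t) ≤ W t q z ∧ W t q z ≤ -t := by
  have hqpos : (0 : ℝ) < q := by exact_mod_cast hq
  have hqne : (q : ℝ) ≠ 0 := hqpos.ne'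
  set c : ℝ := t / q with hcdef
  have hc0 : 0 < c := div_pos ht0 hqpos
  have hcq : c * q = t := by rw [hcdef]; field_simp
  set f : ℝ := Int.fract z with hfdef
  have hf0 : 0 ≤ f := Int.fract_nonneg z
  have hf1 : f < 1 := Int.fract_lt_one z
  have hfz : f = z - ⌊z⌋ := rfl
  -- the shifts `(i+1)c`, `i < q`, lie in `(0, t] ⊆ (0, 1)`
  have hshift : ∀ i ∈ Finset.range q, 0 ≤ ((i : ℝ) + 1) * c ∧ ((i : ℝ) + 1) * c ≤ t := by
    intro i hi
    rw [Finset.mem_range] at hi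
    have hi' : (i : ℝ) + 1 ≤ q := by exact_mod_cast hi
    refine ⟨by positivity, ?_⟩
    calc ((i : ℝ) + 1) * c ≤ q * c := mul_le_mul_of_nonneg_right hi' hc0.le
      _ = t := by rw [mul_comm, hcq]
  -- rewrite the floors as indicator counts
  set SA : ℝ := ∑ i ∈ Finset.range q, (if f < ((i : ℝ) + 1) * c then (1 : ℝ) else 0) with hSA
  set SB : ℝ := ∑ i ∈ Finset.range q, (if 1 ≤ f + ((i : ℝ) + 1) * c then (1 : ℝ) else 0) with hSB
  have hsum : ∑ i ∈ Finset.range q,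
      ((((⌊z - ((i : ℝ) + 1) * (t / q)⌋ : ℤ) : ℝ)) + ((⌊z + ((i : ℝ) + 1) * (t / q)⌋ : ℤ) : ℝ))
      = 2 * q * (⌊z⌋ : ℝ) - SA + SB := by
    rw [← hcdef]
    have hcongr : ∀ i ∈ Finset.range q,
        ((((⌊z - ((i : ℝ) + 1) * c⌋ : ℤ) : ℝ)) + ((⌊z + ((i : ℝ) + 1) * c⌋ : ℤ) : ℝ))
        = 2 * (⌊z⌋ : ℝ) - (if f < ((i : ℝ) + 1) * c then (1 : ℝ) else 0)
            + (if 1 ≤ f + ((i : ℝ) + 1) * c then (1 : ℝ) else 0) := by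
      intro i hi
      obtain ⟨h0, h1⟩ := hshift i hi
      rw [floor_sub_eq_ite h0 (by linarith), floor_add_eq_ite h0 (by linarith)]
      ring
    rw [Finset.sum_congr rfl hcongr, Finset.sum_add_distrib, Finset.sum_sub_distrib, Finset.sum_const, Finset.card_range,
      nsmul_eq_mul]
    ring
  have hW : W t q z = -f - c * SA + c * SB := by
    simp only [W]
    rw [hsum, hfz, ← hcdef]
    have e : t / q * (2 * q * (⌊z⌋ : ℝ) - SA + SB) = 2 * t * (⌊z⌋ : ℝ) - c * SA + c * SB := by
      rw [← hcdef]
      have : c * (2 * q * (⌊z⌋ : ℝ)) = 2 * t * (⌊z⌋ : ℝ) := by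
        calc c * (2 * q * (⌊z⌋ : ℝ)) = 2 * (c * q) * (⌊z⌋ : ℝ) := by ring
          _ = 2 * t * (⌊z⌋ : ℝ) := by rw [hcq]
      linear_combination this
    rw [e]
    ring
  rw [hW]
  -- vanishing of the counts in the three regimes
  have hSA0 : t ≤ f → SA = 0 := by
    intro htf
    apply Finset.sum_eq_zero
    intro i hi
    rw [if_neg]
    push Not
    linarith [(hshift i hi).2]
  have hSB0 : f < 1 - t → SB = 0 := by
    intro hft
    apply Finset.sum_eq_zero
    intro i hi
    rw [if_neg]
    push Not
    linarith [(hshift i hi).2]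
  have hct : c ≤ t := by
    have h1q : (1 : ℝ) ≤ q := by exact_mod_cast hq
    calc c = c * 1 := (mul_one c).symm
      _ ≤ c * q := mul_le_mul_of_nonneg_left h1q hc0.le
      _ = t := hcq
  by_cases hA : f < t
  · -- regime (i): inside the right ring system
    have hB : SB = 0 := hSB0 (by linarith)
    obtain ⟨hlo, hhi⟩ := count_lt_sandwich hc0 hf0 q
    rw [← hSA] at hlo hhi
    have hfc : f / c < q := by
      rw [div_lt_iff₀ hc0, mul_comm, hcq]; exact hA
    rw [max_eq_left (by linarith)] at hhi
    have h1 : t - f ≤ c * SA := by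
      have := mul_le_mul_of_nonneg_left hlo hc0.le
      rw [mul_sub, hcq, mul_div_cancel₀ _ hc0.ne'] at this
      linarith
    have h2 : c * SA ≤ t + c - f := by
      have := mul_le_mul_of_nonneg_left hhi hc0.le
      rw [show c * ((q : ℝ) + 1 - f / c) = c * q + c - c * (f / c) by ring, hcq, mul_div_cancel₀ _ hc0.ne'] at this
      linarith
    rw [hB, mul_zero, add_zero]
    constructor <;> linarith
  · push Not at hA
    have hA0 : SA = 0 := hSA0 hA
    rw [hA0, mul_zero, sub_zero]
    by_cases hB : f < 1 - t
    · -- regime (ii): in the hole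
      rw [hSB0 hB, mul_zero, add_zero]
      constructor <;> linarith
    · -- regime (iii): inside the left ring system of the next planet
      push Not at hB
      set g : ℝ := 1 - f with hgdef
      have hg0 : 0 ≤ g := by linarith
      have hSB' : SB = ∑ i ∈ Finset.range q, (if g ≤ ((i : ℝ) + 1) * c then (1 : ℝ) else 0) := by
        refine Finset.sum_congr rfl fun i _ ↦ ?_
        have : (1 ≤ f + ((i : ℝ) + 1) * c) ↔ (g ≤ ((i : ℝ) + 1) * c) := by rw [hgdef]; constructor <;> intro h <;> linarith
        simp only [this]
      obtain ⟨hlo, hhi⟩ := count_le_sandwich hc0 hg0 q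
      rw [← hSB'] at hlo hhi
      have hgc : g / c ≤ q := by
        rw [div_le_iff₀ hc0, mul_comm, hcq]; linarith
      rw [max_eq_left (by linarith)] at hhi
      have h1 : t - g ≤ c * SB := by
        have := mul_le_mul_of_nonneg_left hlo hc0.le
        rw [mul_sub, hcq, mul_div_cancel₀ _ hc0.ne'] at this
        linarith
      have h2 : c * SB ≤ t + c - g := by
        have := mul_le_mul_of_nonneg_left hhi hc0.le
        rw [show c * ((q : ℝ) + 1 - g / c) = c * q + c - c * (g / c) by ring, hcq, mul_div_cancel₀ _ hc0.ne'] at this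
        linarith
      constructor <;> linarith



end Summit.RiemannHypothesis.RiemannHypothesis.Theorems.Splittings.MassAwareSamplingCeiling
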